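import Summits.Ventures.Crystal3D.Theorems.StickyWulffConstantPolycrystalWulffBoundBallCaps

/-!
# `PolycrystalWulffBound`, line `PolyDensity`: the GENERIC SHIFT LEMMA — across a wall between two
# ARBITRARY lattices the cdf shift (threshold gap) is at most `1 = c₀` (crux `stmt-Ventures-19482`)

Route `StickyWulffConstant` of the venture `Summits/Ventures/Crystal3D`, second prover lane (poly-p2,
gen 14).  The gap-sorted engine (`gapTree_chimera_lower`, `rung_gapTree`) charges a tree edge `i` between
a parent with frame `A` and a child with frame `B` the gap `θ i` of the one-sided cdf-shift hypothesis
`∀ s, |W(A) ∩ {s + θ < ⟪y, n⟫}| ≤ |W(B) ∩ {s < ⟪y, n⟫}|`.  This file proves it with **`θ = 1`** for EVERY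
pair of frames and every unit normal (`cruxWulffBody_cap_shift_one`), so that generic (non-co-axial,
charge `c₀ = 1`) walls of a sorted tree are paid inside the law.  Ingredients, all elementary:
`B̄(0,√3) ⊆ W(X) ⊆ B̄(0,√5)` (in tree), `|W(X)| = 32` and `−W(X) = W(X)` (medians: each open half has
volume `16`, the plane being null), and the volume of a BALL CAP `|B̄(0,R) ∩ {τ < ⟪y,n⟫}| =
π(2R³/3 − R²τ + τ³/3)` (`volume_closedBall_inter_ioi`, by the tree's Cavalieri principle
`volume_eq_lintegral_volume_chartSlice` and the disc area in `ℝ × ℝ`, `volume_prod_disc`).  Cases: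
`s ∈ [−1, 0]` by medians; `s ≥ 0` by `cap_{√5}(s+1) ≤ cap_{√3}(s)` (one quadratic inequality on
`[1, √5]`, margin ≥ 0.38); `s < −1` by complements from the case `−s−1 ≥ 0` with the frames swapped.
Numerically the sharp constant is `√5 − √3 = 0.504` (memo P-GAP-g14 §3); `1` is what the crux's law
`c₀ = 1` needs.
WHAT THIS IS NOT: the sharp constant; anything about co-axial pairs (there `twinSectionShift_inv_sqrt_six`
gives `(1/√6)·sin∠`); the crux is not claimed.
-/

noncomputable section

open scoped BigOperators InnerProductSpace ENNReal Pointwise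
open MeasureTheory Set

namespace Summit.Ventures.Crystal3D.Theorems

open Summit.Ventures.Crystal3D.Cruxes.TextureLiminf.TexShadow (E3)

open Literature.MathematicalPhysics.StatisticalMechanics (fccStacking)

/-! ### Caps of the crux's Wulff bodies: symmetry, complements, ball sandwich -/

/-- Central symmetry of the caps: `|W(X) ∩ {τ < ⟪y,n⟫}| = |W(X) ∩ {⟪y,n⟫ < −τ}|`. -/
theorem volume_cruxWulffBody_cap_eq_neg (X : E3 ≃ₗᵢ[ℝ] E3) (n : E3) (τ : ℝ) :
    volume ({y : E3 | ∀ ν : E3, ⟪y, ν⟫_ℝ ≤ Real.sqrt 2 / 4 *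
        ∑ᶠ w ∈ {w | w ∈ fccStacking 1 (Real.sqrt (2 / 3)) ∧ ‖w‖ = 1}, |⟪w, X.symm ν⟫_ℝ|} ∩
        {y : E3 | τ < ⟪y, n⟫_ℝ}) =
      volume ({y : E3 | ∀ ν : E3, ⟪y, ν⟫_ℝ ≤ Real.sqrt 2 / 4 *
        ∑ᶠ w ∈ {w | w ∈ fccStacking 1 (Real.sqrt (2 / 3)) ∧ ‖w‖ = 1}, |⟪w, X.symm ν⟫_ℝ|} ∩
        {y : E3 | ⟪y, n⟫_ℝ < -τ}) := by
  set body : Set E3 := {y : E3 | ∀ ν : E3, ⟪y, ν⟫_ℝ ≤ Real.sqrt 2 / 4 *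
    ∑ᶠ w ∈ {w | w ∈ fccStacking 1 (Real.sqrt (2 / 3)) ∧ ‖w‖ = 1}, |⟪w, X.symm ν⟫_ℝ|} with hbody
  have hneg : -body = body := neg_cruxWulffBody_eq X
  have hset : body ∩ {y : E3 | ⟪y, n⟫_ℝ < -τ} = -(body ∩ {y : E3 | τ < ⟪y, n⟫_ℝ}) := by
    ext y
    simp only [mem_inter_iff, mem_setOf_eq, Set.mem_neg, inner_neg_left]
    constructor
    · rintro ⟨hy, h⟩
      refine ⟨?_, by linarith⟩
      have : y ∈ -body := by rw [hneg]; exact hy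
      exact this
    · rintro ⟨hy, h⟩
      refine ⟨?_, by linarith⟩
      have : -y ∈ body := hy
      have h2 : y ∈ -body := by simpa [Set.mem_neg] using this
      rwa [hneg] at h2
  rw [hset, Measure.measure_neg]

/-- Complementary caps: `|W(X) ∩ {⟪y,n⟫ < τ}| + |W(X) ∩ {τ < ⟪y,n⟫}| = 32` (the plane is null). -/
theorem volume_cruxWulffBody_caps_add (X : E3 ≃ₗᵢ[ℝ] E3) {n : E3} (hn : ‖n‖ = 1) (τ : ℝ) :
    volume ({y : E3 | ∀ ν : E3, ⟪y, ν⟫_ℝ ≤ Real.sqrt 2 / 4 *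
        ∑ᶠ w ∈ {w | w ∈ fccStacking 1 (Real.sqrt (2 / 3)) ∧ ‖w‖ = 1}, |⟪w, X.symm ν⟫_ℝ|} ∩
        {y : E3 | ⟪y, n⟫_ℝ < τ}) +
      volume ({y : E3 | ∀ ν : E3, ⟪y, ν⟫_ℝ ≤ Real.sqrt 2 / 4 *
        ∑ᶠ w ∈ {w | w ∈ fccStacking 1 (Real.sqrt (2 / 3)) ∧ ‖w‖ = 1}, |⟪w, X.symm ν⟫_ℝ|} ∩
        {y : E3 | τ < ⟪y, n⟫_ℝ}) = ENNReal.ofReal 32 := by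
  set body : Set E3 := {y : E3 | ∀ ν : E3, ⟪y, ν⟫_ℝ ≤ Real.sqrt 2 / 4 *
    ∑ᶠ w ∈ {w | w ∈ fccStacking 1 (Real.sqrt (2 / 3)) ∧ ‖w‖ = 1}, |⟪w, X.symm ν⟫_ℝ|} with hbody
  have hWm : MeasurableSet body := (isCompact_cruxWulffBody X).isClosed.measurableSet
  have hlt : MeasurableSet {y : E3 | ⟪y, n⟫_ℝ < τ} :=
    measurableSet_lt (measurable_id.inner measurable_const) measurable_const
  have hgt : MeasurableSet {y : E3 | τ < ⟪y, n⟫_ℝ} :=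
    measurableSet_lt measurable_const (measurable_id.inner measurable_const)
  have hn0 : n ≠ 0 := by
    intro h; rw [h, norm_zero] at hn; exact zero_ne_one hn
  have hnull : volume {y : E3 | ⟪n, y⟫_ℝ = τ} = 0 := volume_setOf_inner_eq_zero hn0 τ
  have hunion : body \ {y : E3 | ⟪n, y⟫_ℝ = τ} =
      (body ∩ {y : E3 | ⟪y, n⟫_ℝ < τ}) ∪ (body ∩ {y : E3 | τ < ⟪y, n⟫_ℝ}) := by
    ext y
    simp only [mem_sdiff, mem_setOf_eq, mem_union, mem_inter_iff, real_inner_comm n y]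
    constructor
    · rintro ⟨hy, hne⟩
      rcases lt_or_gt_of_ne hne with h | h
      · exact Or.inl ⟨hy, h⟩
      · exact Or.inr ⟨hy, h⟩
    · rintro (⟨hy, h⟩ | ⟨hy, h⟩)
      · exact ⟨hy, ne_of_lt h⟩
      · exact ⟨hy, ne_of_gt h⟩
  have hdisj : Disjoint (body ∩ {y : E3 | ⟪y, n⟫_ℝ < τ}) (body ∩ {y : E3 | τ < ⟪y, n⟫_ℝ}) := by
    rw [Set.disjoint_left]
    rintro y ⟨-, h1⟩ ⟨-, h2⟩
    have h1' : ⟪y, n⟫_ℝ < τ := h1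
    have h2' : τ < ⟪y, n⟫_ℝ := h2
    exact lt_irrefl _ (h1'.trans h2')
  rw [← measure_union hdisj (hWm.inter hgt), ← hunion, measure_sdiff_null hnull]
  exact volume_cruxWulffBody X

/-- `a_X(τ) + a_X(−τ) = 32` for the caps `a_X(τ) = |W(X) ∩ {τ < ⟪y,n⟫}|`. -/
theorem volume_cruxWulffBody_cap_add_cap_neg (X : E3 ≃ₗᵢ[ℝ] E3) {n : E3} (hn : ‖n‖ = 1) (τ : ℝ) :
    volume ({y : E3 | ∀ ν : E3, ⟪y, ν⟫_ℝ ≤ Real.sqrt 2 / 4 *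
        ∑ᶠ w ∈ {w | w ∈ fccStacking 1 (Real.sqrt (2 / 3)) ∧ ‖w‖ = 1}, |⟪w, X.symm ν⟫_ℝ|} ∩
        {y : E3 | τ < ⟪y, n⟫_ℝ}) +
      volume ({y : E3 | ∀ ν : E3, ⟪y, ν⟫_ℝ ≤ Real.sqrt 2 / 4 *
        ∑ᶠ w ∈ {w | w ∈ fccStacking 1 (Real.sqrt (2 / 3)) ∧ ‖w‖ = 1}, |⟪w, X.symm ν⟫_ℝ|} ∩
        {y : E3 | -τ < ⟪y, n⟫_ℝ}) = ENNReal.ofReal 32 := by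
  rw [volume_cruxWulffBody_cap_eq_neg X n (-τ), neg_neg, add_comm]
  exact volume_cruxWulffBody_caps_add X hn τ

/-- The median: `|W(X) ∩ {0 < ⟪y,n⟫}| = 16`. -/
theorem volume_cruxWulffBody_cap_zero (X : E3 ≃ₗᵢ[ℝ] E3) {n : E3} (hn : ‖n‖ = 1) :
    volume ({y : E3 | ∀ ν : E3, ⟪y, ν⟫_ℝ ≤ Real.sqrt 2 / 4 *
        ∑ᶠ w ∈ {w | w ∈ fccStacking 1 (Real.sqrt (2 / 3)) ∧ ‖w‖ = 1}, |⟪w, X.symm ν⟫_ℝ|} ∩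
        {y : E3 | 0 < ⟪y, n⟫_ℝ}) = ENNReal.ofReal 16 := by
  have h := volume_cruxWulffBody_cap_add_cap_neg X hn 0
  rw [neg_zero] at h
  set v := volume ({y : E3 | ∀ ν : E3, ⟪y, ν⟫_ℝ ≤ Real.sqrt 2 / 4 *
        ∑ᶠ w ∈ {w | w ∈ fccStacking 1 (Real.sqrt (2 / 3)) ∧ ‖w‖ = 1}, |⟪w, X.symm ν⟫_ℝ|} ∩
        {y : E3 | 0 < ⟪y, n⟫_ℝ}) with hv
  have hvtop : v ≠ ⊤ := by
    intro ht; rw [ht, top_add] at h; exact ENNReal.ofReal_ne_top h.symm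
  have h2 : (2 : ℝ≥0∞) * v = ENNReal.ofReal 32 := by rw [two_mul]; exact h
  have h3 : v = ENNReal.ofReal 32 / 2 := by
    rw [← h2, mul_comm, ENNReal.mul_div_cancel_right (by norm_num) (by norm_num)]
  rw [h3, show (2 : ℝ≥0∞) = ENNReal.ofReal 2 by norm_num, ← ENNReal.ofReal_div_of_pos (by norm_num)]
  norm_num

/-- Ball sandwich, upper: a cap of `W(X)` is at most the same cap of `B̄(0, √5)`. -/
theorem volume_cruxWulffBody_cap_le_ball (X : E3 ≃ₗᵢ[ℝ] E3) (n : E3) (τ : ℝ) :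
    volume ({y : E3 | ∀ ν : E3, ⟪y, ν⟫_ℝ ≤ Real.sqrt 2 / 4 *
        ∑ᶠ w ∈ {w | w ∈ fccStacking 1 (Real.sqrt (2 / 3)) ∧ ‖w‖ = 1}, |⟪w, X.symm ν⟫_ℝ|} ∩
        {y : E3 | τ < ⟪y, n⟫_ℝ}) ≤
      volume (Metric.closedBall (0 : E3) (Real.sqrt 5) ∩ {y : E3 | τ < ⟪y, n⟫_ℝ}) :=
  measure_mono (inter_subset_inter_left _ (cruxWulffBody_subset_closedBall X))

/-- Ball sandwich, lower: a cap of `W(X)` is at least the same cap of `B̄(0, √3)`. -/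
theorem volume_ball_cap_le_cruxWulffBody (X : E3 ≃ₗᵢ[ℝ] E3) (n : E3) (τ : ℝ) :
    volume (Metric.closedBall (0 : E3) (Real.sqrt 3) ∩ {y : E3 | τ < ⟪y, n⟫_ℝ}) ≤
      volume ({y : E3 | ∀ ν : E3, ⟪y, ν⟫_ℝ ≤ Real.sqrt 2 / 4 *
        ∑ᶠ w ∈ {w | w ∈ fccStacking 1 (Real.sqrt (2 / 3)) ∧ ‖w‖ = 1}, |⟪w, X.symm ν⟫_ℝ|} ∩
        {y : E3 | τ < ⟪y, n⟫_ℝ}) :=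
  measure_mono (inter_subset_inter_left _ (closedBall_subset_cruxWulffBody X))

/-! ### The generic shift lemma -/

/-- **Generic cdf shift ≤ 1, the half-line `s ≥ −1`.** -/
theorem cruxWulffBody_cap_shift_one_of_ge (A B : E3 ≃ₗᵢ[ℝ] E3) {n : E3} (hn : ‖n‖ = 1) {s : ℝ}
    (hs : -1 ≤ s) :
    volume ({y : E3 | ∀ ν : E3, ⟪y, ν⟫_ℝ ≤ Real.sqrt 2 / 4 *
        ∑ᶠ w ∈ {w | w ∈ fccStacking 1 (Real.sqrt (2 / 3)) ∧ ‖w‖ = 1}, |⟪w, A.symm ν⟫_ℝ|} ∩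
        {y : E3 | s + 1 < ⟪y, n⟫_ℝ}) ≤
      volume ({y : E3 | ∀ ν : E3, ⟪y, ν⟫_ℝ ≤ Real.sqrt 2 / 4 *
        ∑ᶠ w ∈ {w | w ∈ fccStacking 1 (Real.sqrt (2 / 3)) ∧ ‖w‖ = 1}, |⟪w, B.symm ν⟫_ℝ|} ∩
        {y : E3 | s < ⟪y, n⟫_ℝ}) := by
  set WA : Set E3 := {y : E3 | ∀ ν : E3, ⟪y, ν⟫_ℝ ≤ Real.sqrt 2 / 4 *
    ∑ᶠ w ∈ {w | w ∈ fccStacking 1 (Real.sqrt (2 / 3)) ∧ ‖w‖ = 1}, |⟪w, A.symm ν⟫_ℝ|} with hWA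
  set WB : Set E3 := {y : E3 | ∀ ν : E3, ⟪y, ν⟫_ℝ ≤ Real.sqrt 2 / 4 *
    ∑ᶠ w ∈ {w | w ∈ fccStacking 1 (Real.sqrt (2 / 3)) ∧ ‖w‖ = 1}, |⟪w, B.symm ν⟫_ℝ|} with hWB
  have h5pos : 0 < Real.sqrt 5 := Real.sqrt_pos.2 (by norm_num)
  have h3pos : 0 < Real.sqrt 3 := Real.sqrt_pos.2 (by norm_num)
  by_cases htop : Real.sqrt 5 ≤ s + 1
  · -- the `A`-cap is empty
    have hempty : WA ∩ {y : E3 | s + 1 < ⟪y, n⟫_ℝ} = ∅ := by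
      ext y
      simp only [mem_inter_iff, mem_setOf_eq, mem_empty_iff_false, iff_false, not_and, not_lt]
      intro hy
      have hy5 : ‖y‖ ≤ Real.sqrt 5 := mem_closedBall_zero_iff.1 (cruxWulffBody_subset_closedBall A hy)
      have h1 : ⟪y, n⟫_ℝ ≤ ‖y‖ * ‖n‖ := real_inner_le_norm _ _
      rw [hn, mul_one] at h1
      linarith
    rw [hempty, measure_empty]
    exact bot_le
  rw [not_le] at htop
  by_cases h0 : 0 ≤ s
  · -- ball caps: `a_A(s+1) ≤ cap_{√5}(s+1) ≤ cap_{√3}(s) ≤ a_B(s)`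
    have hs3 : s ≤ Real.sqrt 3 := by
      have h31 : Real.sqrt 5 < Real.sqrt 3 + 1 := by
        have h3lo : (1.732 : ℝ) < Real.sqrt 3 := by rw [Real.lt_sqrt (by norm_num)]; norm_num
        have h5hi : Real.sqrt 5 < (2.2361 : ℝ) := by rw [Real.sqrt_lt' (by norm_num)]; norm_num
        linarith
      linarith
    calc volume (WA ∩ {y : E3 | s + 1 < ⟪y, n⟫_ℝ})
        ≤ volume (Metric.closedBall (0 : E3) (Real.sqrt 5) ∩ {y : E3 | s + 1 < ⟪y, n⟫_ℝ}) :=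
          volume_cruxWulffBody_cap_le_ball A n (s + 1)
      _ = ENNReal.ofReal (Real.pi * (2 * Real.sqrt 5 ^ 3 / 3 - Real.sqrt 5 ^ 2 * (s + 1) + (s + 1) ^ 3 / 3)) :=
          volume_closedBall_inter_ioi hn h5pos htop.le (by linarith)
      _ ≤ ENNReal.ofReal (Real.pi * (2 * Real.sqrt 3 ^ 3 / 3 - Real.sqrt 3 ^ 2 * s + s ^ 3 / 3)) := by
          apply ENNReal.ofReal_le_ofReal
          have h := ballCap_five_le_ballCap_three (σ := s + 1) (by linarith) htop.le
          simp only [add_sub_cancel_right] at h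
          exact h
      _ = volume (Metric.closedBall (0 : E3) (Real.sqrt 3) ∩ {y : E3 | s < ⟪y, n⟫_ℝ}) :=
          (volume_closedBall_inter_ioi hn h3pos hs3 (by linarith)).symm
      _ ≤ volume (WB ∩ {y : E3 | s < ⟪y, n⟫_ℝ}) := volume_ball_cap_le_cruxWulffBody B n s
  · -- medians: `a_A(s+1) ≤ a_A(0) = 16 = a_B(0) ≤ a_B(s)`
    rw [not_le] at h0
    calc volume (WA ∩ {y : E3 | s + 1 < ⟪y, n⟫_ℝ})
        ≤ volume (WA ∩ {y : E3 | 0 < ⟪y, n⟫_ℝ}) :=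
          measure_mono (inter_subset_inter_right _ fun y (hy : s + 1 < ⟪y, n⟫_ℝ) => by
            show 0 < ⟪y, n⟫_ℝ; linarith)
      _ = ENNReal.ofReal 16 := volume_cruxWulffBody_cap_zero A hn
      _ = volume (WB ∩ {y : E3 | 0 < ⟪y, n⟫_ℝ}) := (volume_cruxWulffBody_cap_zero B hn).symm
      _ ≤ volume (WB ∩ {y : E3 | s < ⟪y, n⟫_ℝ}) :=
          measure_mono (inter_subset_inter_right _ fun y (hy : 0 < ⟪y, n⟫_ℝ) => by
            show s < ⟪y, n⟫_ℝ; linarith)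

/-- **Generic cdf shift ≤ 1** (the uniform gap for a wall between two ARBITRARY lattices): for all
frames `A, B`, unit `n` and `s`, `|W(A) ∩ {s + 1 < ⟪y,n⟫}| ≤ |W(B) ∩ {s < ⟪y,n⟫}|`.  Proof: ball
sandwich `B̄(0,√3) ⊆ W ⊆ B̄(0,√5)`, medians (central symmetry, `|W| = 32`), ball caps; the half-line
`s < −1` follows from `s' = −s−1 ≥ 0` with the frames swapped, by `a_X(τ) + a_X(−τ) = 32`. -/
theorem cruxWulffBody_cap_shift_one (A B : E3 ≃ₗᵢ[ℝ] E3) {n : E3} (hn : ‖n‖ = 1) (s : ℝ) :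
    volume ({y : E3 | ∀ ν : E3, ⟪y, ν⟫_ℝ ≤ Real.sqrt 2 / 4 *
        ∑ᶠ w ∈ {w | w ∈ fccStacking 1 (Real.sqrt (2 / 3)) ∧ ‖w‖ = 1}, |⟪w, A.symm ν⟫_ℝ|} ∩
        {y : E3 | s + 1 < ⟪y, n⟫_ℝ}) ≤
      volume ({y : E3 | ∀ ν : E3, ⟪y, ν⟫_ℝ ≤ Real.sqrt 2 / 4 *
        ∑ᶠ w ∈ {w | w ∈ fccStacking 1 (Real.sqrt (2 / 3)) ∧ ‖w‖ = 1}, |⟪w, B.symm ν⟫_ℝ|} ∩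
        {y : E3 | s < ⟪y, n⟫_ℝ}) := by
  by_cases hs : -1 ≤ s
  · exact cruxWulffBody_cap_shift_one_of_ge A B hn hs
  rw [not_le] at hs
  -- complements: `a_A(s+1) = 32 − a_A(−s−1)`, `a_B(s) = 32 − a_B(−s)`, and `a_B(−s) ≤ a_A(−s−1)`
  have hA := volume_cruxWulffBody_cap_add_cap_neg A hn (s + 1)
  have hB := volume_cruxWulffBody_cap_add_cap_neg B hn s
  have haux := cruxWulffBody_cap_shift_one_of_ge B A hn (s := -s - 1) (by linarith)
  have heq : -s - 1 + 1 = -s := by ring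
  rw [heq] at haux
  have heq2 : -(s + 1) = -s - 1 := by ring
  rw [heq2] at hA
  set aA := volume ({y : E3 | ∀ ν : E3, ⟪y, ν⟫_ℝ ≤ Real.sqrt 2 / 4 *
        ∑ᶠ w ∈ {w | w ∈ fccStacking 1 (Real.sqrt (2 / 3)) ∧ ‖w‖ = 1}, |⟪w, A.symm ν⟫_ℝ|} ∩
        {y : E3 | s + 1 < ⟪y, n⟫_ℝ}) with haA
  set aA' := volume ({y : E3 | ∀ ν : E3, ⟪y, ν⟫_ℝ ≤ Real.sqrt 2 / 4 *
        ∑ᶠ w ∈ {w | w ∈ fccStacking 1 (Real.sqrt (2 / 3)) ∧ ‖w‖ = 1}, |⟪w, A.symm ν⟫_ℝ|} ∩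
        {y : E3 | -s - 1 < ⟪y, n⟫_ℝ}) with haA'
  set aB := volume ({y : E3 | ∀ ν : E3, ⟪y, ν⟫_ℝ ≤ Real.sqrt 2 / 4 *
        ∑ᶠ w ∈ {w | w ∈ fccStacking 1 (Real.sqrt (2 / 3)) ∧ ‖w‖ = 1}, |⟪w, B.symm ν⟫_ℝ|} ∩
        {y : E3 | s < ⟪y, n⟫_ℝ}) with haB
  set aB' := volume ({y : E3 | ∀ ν : E3, ⟪y, ν⟫_ℝ ≤ Real.sqrt 2 / 4 *
        ∑ᶠ w ∈ {w | w ∈ fccStacking 1 (Real.sqrt (2 / 3)) ∧ ‖w‖ = 1}, |⟪w, B.symm ν⟫_ℝ|} ∩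
        {y : E3 | -s < ⟪y, n⟫_ℝ}) with haB'
  have hA'top : aA' ≠ ⊤ := by
    intro ht; rw [ht, add_top] at hA; exact ENNReal.ofReal_ne_top hA.symm
  have hB'top : aB' ≠ ⊤ := by
    intro ht; rw [ht, add_top] at hB; exact ENNReal.ofReal_ne_top hB.symm
  have h1 : aA = ENNReal.ofReal 32 - aA' := ENNReal.eq_sub_of_add_eq hA'top hA
  have h2 : aB = ENNReal.ofReal 32 - aB' := ENNReal.eq_sub_of_add_eq hB'top hB
  rw [h1, h2]
  exact tsub_le_tsub_left haux _

end Summit.Ventures.Crystal3D.Theorems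

end
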